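import Mathlib
import Summits.BirchSwinnertonDyer.BirchSwinnertonDyer.Theorems.ResidualThetaTransportAtTwoLambdaLowerBoundOWeierstrass
import Summits.BirchSwinnertonDyer.BirchSwinnertonDyer.Theorems.ResidualThetaTransportAtTwoDefs
import Literature.Barriers.BirchSwinnertonDyer.PAdicFunctionalEquationParity
import Literature.NumberTheory.EllipticCurves.IwasawaAlgebraInvolution

/-!
# Sketch (stub-ideation k2 · g19) — the k2 lane's S109 PRICE in kernel:
# **H10** (Λ_𝒪-trivialisation package, pure algebra), **H12** (involution transport of `λ_𝒪`),
# **W-d** (`lamO S (Λ_𝒪 ⧸ (Lm)) = d` on the crux's carriers), and **H9**'s typed socket.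

Crux `(R≥)ᵖ` `ResidualThetaCountLowerPureAtTwo` (stmt-BirchSwinnertonDyer-26074); stub
`stub_cmLambdaLower : ResidualSignedLambdaLowerCMAtTwo` (= RSL_g, item 22608; skeleton `Lines/bt26_lambda.lean`
v7, line `onepair` v3d).  STUB-PLAN rev 24.1 S109 / rev 25.1 adopts k2-g18's `(i)`-half adapter BY NAME and
lists its PRICE «none kernel-checked yet»: H8 · **H9** · **H10** · H-BKρ · H11 (print) · **H12** · **W-d**.
This file kernel-checks H10, H12 (abstract form) and W-d (RTT currency), and types the socket H9 plugs into.

§1 **H10a** `nonempty_linearEquiv_of_finrank_match` — V105 (b) as a theorem: an `𝒪`-torsion-free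
   `𝒪`-module, finite over `R` with `finrank_R M = finrank_R 𝒪 ≠ 0`, is `≃ₗ[𝒪] 𝒪` (PID structure theorem
   `Module.free_of_finite_type_torsion_free'` + tower law `Module.finrank_mul_finrank` + rank one).
§2 **H10b** `exists_trivialisation` — unbundled, for a faithful `A : 𝒪 →ₐ[R] End_R V` (H9's `Aρ`);
   `smul_faithful_of_isAlgebraic` / `exists_trivialisation'` — faithfulness is AUTOMATIC (𝒪 a domain algebraic / R).
§3 **H10c** `coeffwiseEquiv : (Fin n → R⟦X⟧) ≃ₗ[R⟦X⟧] 𝒪⟦X⟧`, `coeffwise_coeffAct` (intertwines `A` with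
   constants), `coeffAct_matrix` (H9's matrix currency), `coeffwise_eq_sum` (`𝒪⟦X⟧ = ⊕ᵢ R⟦X⟧·C bᵢ`).
§4 **H10d** `trivialisation_semilinear` / `trivialisation_linear` — ASSEMBLY: H8 (X-(semi)linearity) ∧ H9
   (constants through `A`) ⇒ `e ∘ c` is `𝒪⟦X⟧`-(semi)linear; finite decomposition only, no topology.
§4b **H9-pkg** `exists_unique_toZModPow_eq` / `exists_unique_matrix_toZModPow_eq` — compatible levelwise
   residues / matrices mod `2^k` are reductions of a unique `2`-adic integer / matrix (`PadicInt.lift` on `ℤ[X]`).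
§5 **H12** `finrank_baseChange_quot_span_algEquiv` — `dim_K (K ⊗_A Λ⧸(σ h)) = dim_K (K ⊗_A Λ⧸(h))` for an
   `A`-algebra automorphism `σ` (`Ideal.quotientEquivAlg` + `LinearEquiv.baseChange`; cf. k1-g7's
   `finrank_baseChange_quotient_map_equiv` for `A`-linear `γ`, `N.map γ`).
§5b **D1** `iota : A⟦X⟧ ≃ₐ[A] A⟦X⟧`, the Iwasawa involution `X ↦ (1+X)⁻¹ - 1` over a GENERAL coefficient ring
   `A` (needed for `A = 𝒪 = padicCoeffIntegers S` on `IwasawaAlgebraO S`).  RECOGNISED (family 1, tree match): the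
   tree has it over `ℤ_[p]` ONLY — `Literature.NumberTheory.EllipticCurves.IwasawaAlgebra.invol / involEquiv`
   (`invol_invol`, `invol_C`; `IwasawaAlgebraInvolution.lean`), with `λ`-transport over `ℤ_[p]`
   (`lambdaInvariant_eq_of_involSemilinear`, `lambdaInvariant_quotient_comap_invol_eq`) — and has the substituted
   SERIES over any `R` (`Literature.Barriers.BirchSwinnertonDyer.invOnePlusSubOne`, `hasSubst_invOnePlusSubOne`,
   `invOnePlusSubOne_subst_self [IsDomain R]`).  This section is the PORT to general `A` built ON the tree's series
   (no new series; involutivity without `IsDomain`), with the AGREEMENT `iota_eq_invol : iota f = IwasawaAlgebra.invol p f`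
   at `A = ℤ_[p]` and the compatibility `iota_map_eq_map_invol` (= `hτmap` of §4 for `τ := invol 2`, `τO := iota`);
   `iota_iota`, `iota_one_add_X_mul`, `map_iota`, `iota_C`; and in §6b `lamO_quot_span_iota_eq` = **H12 in RTT
   currency** (`𝒪`-coefficients, `lamO`): `lamO S (Λ_𝒪 ⧸ (ι h)) = lamO S (Λ_𝒪 ⧸ (h))` — absent from the tree, whose
   `λ`-transport is `lambdaInvariant p` over `ℤ_[p]⟦X⟧`.
§6 **W-d** `lamO_quotient_span_eq_of_normLambda_iwasawaAlgebraO` — ON THE CRUX'S CARRIERS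
   (`IwasawaAlgebraO S`, `padicCoeffIntegers S`, RSL_g's norm binders verbatim): `lamO S (Λ_𝒪 ⧸ (Lm)) = d`.
   RECOGNISED (family 1, tree match): this is k3-g4's μ-safe count `finrank_baseChange_quotient_span_eq_of_normLambda_field`
   / `…_iwasawaAlgebraO` (`Cruxes/…/Sketch_sidea_k3_g4.lean` §G, ll. 68/116, sha16 e3f3b95318e13e3e — a crux
   workfile, not yet a `Theorems/` port) BY CONTENT; re-checked here independently, for ANY field `K` with injective
   `algebraMap 𝒪_E K` (k3-g4: `IsFractionRing`), and wrapped in the seam's `lamO` currency (`OnePair.lamO_eq`).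
   (The torsion bridge `finrank_baseChange_eq_finrank_quotientTorsion` is NOT usable: `Λ_𝒪⧸(Lm)` is not
   `𝒪`-finite when `μ(Lm) > 0` — k3-g4's remark, confirmed.)

Dictionary (sketch ↦ RTT): `R ↦ ℤ_[2]`, `𝒪 ↦ ↥(padicCoeffIntegers S)` with `letI := (padicIntToCoeffIntegers S).toAlgebra`
INSIDE proofs only (T64), `R⟦X⟧ ↦ Λ₀ = PowerSeries ℤ_[2]`, `𝒪⟦X⟧ ↦ Λ_𝒪 = IwasawaAlgebraO S` with
`algebraMap = PowerSeries.map (algebraMap ℤ_[2] 𝒪) = iwasawaToIwasawaO S` (`PowerSeries.algebraPowerSeries`,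
`rfl`), `H ↦ I.H`, `c ↦ π.cvec` (as `→+`), `A ↦ toLinAlgEquiv' ∘ Aρ` (H9), `τ, τO ↦` the Iwasawa involution
`X ↦ (1+X)⁻¹ - 1` on `Λ₀` (tree: `IwasawaAlgebra.invol 2`), `Λ_𝒪` (`iota`, D1) (or `id`), `σ ↦ iota` as an `𝒪`-algebra automorphism,
`K ↦ FractionRing 𝒪` (so §5/§6 are `lamO S _` by `OnePair.lamO_eq`, definitional).

HONEST FRAMING: THEOREMS ONLY (no instance, no named fact, 0 `sorry`); BSD is NOT proved by any of this;
items 22608 / 26074 stay OPEN, 24105 on HOLD; nothing here touches the pen's print lane (H11/H-BKρ),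
file (C) (PERF₂/E⁺), the LEAD's `locdS`, S4₀, or EH.
-/

set_option autoImplicit false
set_option linter.dupNamespace false

namespace Summit.BirchSwinnertonDyer.BirchSwinnertonDyer.Cruxes.ResidualThetaCountLowerPureAtTwo.SideaK2G19
set_option linter.dupNamespace false

noncomputable section

open PowerSeries
open scoped TensorProduct

/-! ## §1 · H10a — rank-match freeness over a PID -/

section RankMatch

/-- **H10a.**  `𝒪` a PID, free of finite rank `f ≠ 0` over `R`; `M` an `𝒪`-module (compatible with
`R`), finitely generated over `R`, `𝒪`-torsion-free, with `finrank_R M = f`.  Then `M ≃ₗ[𝒪] 𝒪`.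
(RTT: `M = ℤ₂ⁿ` = the coefficient lattice of `cvec`, `𝒪`-action through `Aρ` (H9), `n = f`
by `π.hB` / `exists_dualGenerator`.) -/
theorem nonempty_linearEquiv_of_finrank_match (R 𝒪 M : Type*) [CommRing R] [StrongRankCondition R]
    [CommRing 𝒪] [IsDomain 𝒪] [IsPrincipalIdealRing 𝒪] [Algebra R 𝒪]
    [Module.Free R 𝒪] [Module.Finite R 𝒪]
    [AddCommGroup M] [Module R M] [Module 𝒪 M] [IsScalarTower R 𝒪 M]
    [Module.Finite R M] [Module.IsTorsionFree 𝒪 M]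
    (hn : Module.finrank R 𝒪 ≠ 0) (h : Module.finrank R M = Module.finrank R 𝒪) :
    Nonempty (M ≃ₗ[𝒪] 𝒪) := by
  haveI : Module.Finite 𝒪 M := Module.Finite.of_restrictScalars_finite R 𝒪 M
  haveI : Module.Free 𝒪 M := Module.free_of_finite_type_torsion_free'
  have ht : Module.finrank R 𝒪 * Module.finrank 𝒪 M = Module.finrank R M :=
    Module.finrank_mul_finrank R 𝒪 M
  have h1 : Module.finrank 𝒪 M = 1 := by
    apply Nat.eq_of_mul_eq_mul_left (Nat.pos_of_ne_zero hn)
    rw [mul_one, ht, h]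
  exact ⟨(Module.nonempty_linearEquiv_of_finrank_eq_one h1).some.symm⟩

end RankMatch

/-! ## §2 · H10b — unbundled form: a faithful `𝒪`-action on an `R`-lattice of rank `f` -/

section Unbundled

variable {R 𝒪 V : Type*} [CommRing R] [StrongRankCondition R]
    [CommRing 𝒪] [IsDomain 𝒪] [IsPrincipalIdealRing 𝒪] [Algebra R 𝒪]
    [Module.Free R 𝒪] [Module.Finite R 𝒪]
    [AddCommGroup V] [Module R V] [Module.Finite R V]

/-- **H10b.**  An `R`-algebra action `A : 𝒪 → End_R V` without zero-divisors on an `R`-module `V`,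
finite over `R` with `finrank_R V = finrank_R 𝒪 ≠ 0`, is trivialisable: `V ≃ₗ[R] 𝒪` carrying
`A a` to multiplication by `a`.  (RTT: `V = Fin n → ℤ_[2]`, `A a = Matrix.vecMulLinear (Aρ a)`.) -/
theorem exists_trivialisation (A : 𝒪 →ₐ[R] Module.End R V)
    (hA : ∀ (a : 𝒪) (v : V), A a v = 0 → a = 0 ∨ v = 0)
    (hn : Module.finrank R 𝒪 ≠ 0) (h : Module.finrank R V = Module.finrank R 𝒪) :
    ∃ e₀ : V ≃ₗ[R] 𝒪, ∀ (a : 𝒪) (v : V), e₀ (A a v) = a * e₀ v := by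
  letI : Module 𝒪 V := Module.compHom V A.toRingHom
  have hsmul : ∀ (a : 𝒪) (v : V), a • v = A a v := fun _ _ => rfl
  haveI : IsScalarTower R 𝒪 V := ⟨fun r a v => by
    rw [hsmul, hsmul, map_smul, LinearMap.smul_apply]⟩
  haveI : Module.IsTorsionFree 𝒪 V :=
    Module.IsTorsionFree.of_smul_eq_zero fun a v hav => hA a v (by rwa [← hsmul])
  obtain ⟨e⟩ := nonempty_linearEquiv_of_finrank_match R 𝒪 V hn h
  refine ⟨e.restrictScalars R, fun a v => ?_⟩
  rw [LinearEquiv.restrictScalars_apply, LinearEquiv.restrictScalars_apply, ← hsmul, map_smul,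
    smul_eq_mul]

omit [StrongRankCondition R] [IsPrincipalIdealRing 𝒪] [Module.Free R 𝒪] [Module.Finite R 𝒪] [Module.Finite R V] in
/-- **H10b-tf — the «no zero-divisors» hypothesis `hA` of H10b is AUTOMATIC.**  If `𝒪` is a domain algebraic
over `R` (RTT: `𝒪 = padicCoeffIntegers S` is finite over `ℤ_[2]`, `Algebra.IsAlgebraic.of_finite`) and `V` has no
`R`-zero-smul-divisors (RTT: `ℤ_[2]ⁿ`), then every `R`-algebra action `A : 𝒪 → End_R V` is without zero-divisors:
a nonzero algebraic `a` divides some nonzero `r ∈ R` in `𝒪` (`IsAlgebraic.exists_nonzero_dvd`), so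
`A a v = 0 ⇒ r • v = A u (A a v) = 0 ⇒ v = 0`.  (No appeal to `Frac 𝒪` or to invertibility of matrices.) -/
theorem smul_faithful_of_isAlgebraic [Algebra.IsAlgebraic R 𝒪] [NoZeroSMulDivisors R V]
    (A : 𝒪 →ₐ[R] Module.End R V) (a : 𝒪) (v : V) (hav : A a v = 0) : a = 0 ∨ v = 0 := by
  by_cases ha : a = 0
  · exact Or.inl ha
  right
  obtain ⟨r, hr, u, hu⟩ :=
    (Algebra.IsAlgebraic.isAlgebraic (R := R) a).exists_nonzero_dvd (mem_nonZeroDivisors_of_ne_zero ha)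
  have h1 : r • v = 0 := by
    have h2 : A (algebraMap R 𝒪 r) v = r • v := by
      rw [AlgHom.commutes, Module.algebraMap_end_apply]
    rw [← h2, hu, mul_comm, map_mul]
    exact (show (A u * A a) v = A u (A a v) from rfl).trans (by rw [hav, map_zero])
  exact (NoZeroSMulDivisors.eq_zero_or_eq_zero_of_smul_eq_zero h1).resolve_left hr

/-- **H10b′ — H10b with `hA` discharged**: for a domain `𝒪` algebraic over `R` and `V` without
`R`-zero-smul-divisors, ANY `R`-algebra action `A : 𝒪 → End_R V` with `finrank_R V = finrank_R 𝒪 ≠ 0`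
is trivialisable.  RTT: the only inputs left are H9's `Aρ` (an algebra map) and `n = f`. -/
theorem exists_trivialisation' [Algebra.IsAlgebraic R 𝒪] [NoZeroSMulDivisors R V]
    (A : 𝒪 →ₐ[R] Module.End R V)
    (hn : Module.finrank R 𝒪 ≠ 0) (h : Module.finrank R V = Module.finrank R 𝒪) :
    ∃ e₀ : V ≃ₗ[R] 𝒪, ∀ (a : 𝒪) (v : V), e₀ (A a v) = a * e₀ v :=
  exists_trivialisation A (smul_faithful_of_isAlgebraic A) hn h

end Unbundled

/-! ## §3 · H10c — coefficientwise extension to power series -/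

section Coeffwise

variable {R 𝒪 : Type*} [CommRing R] [CommRing 𝒪] [Algebra R 𝒪] {n : ℕ}

/-- The `m`-th coefficient vector of a tuple of power series. -/
def coeffVec (m : ℕ) (g : Fin n → R⟦X⟧) : Fin n → R := fun i => coeff m (g i)

@[simp] theorem coeffVec_apply (m : ℕ) (g : Fin n → R⟦X⟧) (i : Fin n) :
    coeffVec m g i = coeff m (g i) := rfl

theorem coeffVec_add (m : ℕ) (g g' : Fin n → R⟦X⟧) :
    coeffVec m (g + g') = coeffVec m g + coeffVec m g' := by
  funext i; simp

theorem coeffVec_smul (r : R⟦X⟧) (g : Fin n → R⟦X⟧) (m : ℕ) :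
    coeffVec m (r • g) = ∑ p ∈ Finset.HasAntidiagonal.antidiagonal m, coeff p.1 r • coeffVec p.2 g := by
  funext i
  simp only [coeffVec_apply, Pi.smul_apply, smul_eq_mul, coeff_mul, Finset.sum_apply]

/-- Coefficientwise application of `e₀ : Rⁿ ≃ 𝒪`. -/
def coeffwise (e₀ : (Fin n → R) ≃ₗ[R] 𝒪) (g : Fin n → R⟦X⟧) : 𝒪⟦X⟧ :=
  PowerSeries.mk fun m => e₀ (coeffVec m g)

@[simp] theorem coeff_coeffwise (e₀ : (Fin n → R) ≃ₗ[R] 𝒪) (g : Fin n → R⟦X⟧) (m : ℕ) :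
    coeff m (coeffwise e₀ g) = e₀ (coeffVec m g) := by
  simp [coeffwise, coeff_mk]

/-- Coefficientwise inverse. -/
def coeffwiseInv (e₀ : (Fin n → R) ≃ₗ[R] 𝒪) (ψ : 𝒪⟦X⟧) : Fin n → R⟦X⟧ :=
  fun i => PowerSeries.mk fun m => e₀.symm (coeff m ψ) i

theorem coeffwise_add (e₀ : (Fin n → R) ≃ₗ[R] 𝒪) (g g' : Fin n → R⟦X⟧) :
    coeffwise e₀ (g + g') = coeffwise e₀ g + coeffwise e₀ g' := by
  ext m; simp [coeffVec_add]

/-- `R⟦X⟧`-linearity of the coefficientwise map (Cauchy product vs. `R`-linearity of `e₀`). -/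
theorem coeffwise_smul (e₀ : (Fin n → R) ≃ₗ[R] 𝒪) (r : R⟦X⟧) (g : Fin n → R⟦X⟧) :
    coeffwise e₀ (r • g) = PowerSeries.map (algebraMap R 𝒪) r * coeffwise e₀ g := by
  ext m
  rw [coeff_coeffwise, coeffVec_smul, map_sum, coeff_mul]
  refine Finset.sum_congr rfl fun p _ => ?_
  rw [map_smul, coeff_map, coeff_coeffwise, Algebra.smul_def]

theorem coeffwise_coeffwiseInv (e₀ : (Fin n → R) ≃ₗ[R] 𝒪) (ψ : 𝒪⟦X⟧) :
    coeffwise e₀ (coeffwiseInv e₀ ψ) = ψ := by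
  ext m
  have : coeffVec m (coeffwiseInv e₀ ψ) = e₀.symm (coeff m ψ) := by
    funext i; simp [coeffwiseInv, coeff_mk]
  rw [coeff_coeffwise, this, LinearEquiv.apply_symm_apply]

theorem coeffwiseInv_coeffwise (e₀ : (Fin n → R) ≃ₗ[R] 𝒪) (g : Fin n → R⟦X⟧) :
    coeffwiseInv e₀ (coeffwise e₀ g) = g := by
  funext i; ext m
  simp [coeffwiseInv, coeff_mk]

/-- **H10c.**  The coefficientwise trivialisation `(Fin n → R⟦X⟧) ≃ₗ[R⟦X⟧] 𝒪⟦X⟧` induced by any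
`R`-linear `e₀ : Rⁿ ≃ 𝒪` (the `R⟦X⟧`-module structure on `𝒪⟦X⟧` is Mathlib's
`PowerSeries.algebraPowerSeries`, i.e. through `PowerSeries.map (algebraMap R 𝒪)` — in RTT this is
`iwasawaToIwasawaO S` by `rfl`, T64). -/
def coeffwiseEquiv (e₀ : (Fin n → R) ≃ₗ[R] 𝒪) : (Fin n → R⟦X⟧) ≃ₗ[R⟦X⟧] 𝒪⟦X⟧ where
  toFun := coeffwise e₀
  invFun := coeffwiseInv e₀
  map_add' := coeffwise_add e₀
  map_smul' r g := by
    rw [coeffwise_smul, RingHom.id_apply, Algebra.smul_def, algebraMap_apply'']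
  left_inv := coeffwiseInv_coeffwise e₀
  right_inv := coeffwise_coeffwiseInv e₀

@[simp] theorem coeffwiseEquiv_apply (e₀ : (Fin n → R) ≃ₗ[R] 𝒪) (g : Fin n → R⟦X⟧) :
    coeffwiseEquiv e₀ g = coeffwise e₀ g := rfl

/-- The coefficientwise action of `a ∈ 𝒪` through `A` on tuples of power series
(RTT, with `A a = Matrix.vecMulLinear (Aρ a)`: `fun i ↦ ∑ j, C (Aρ a j i) * g j`, H9's currency). -/
def coeffAct (A : 𝒪 →ₐ[R] Module.End R (Fin n → R)) (a : 𝒪) (g : Fin n → R⟦X⟧) :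
    Fin n → R⟦X⟧ :=
  fun i => PowerSeries.mk fun m => A a (coeffVec m g) i

theorem coeffVec_coeffAct (A : 𝒪 →ₐ[R] Module.End R (Fin n → R)) (a : 𝒪) (g : Fin n → R⟦X⟧)
    (m : ℕ) : coeffVec m (coeffAct A a g) = A a (coeffVec m g) := by
  funext i; simp [coeffAct, coeff_mk]

/-- **H10c′.**  The coefficientwise trivialisation intertwines the `A`-action with constants. -/
theorem coeffwise_coeffAct (e₀ : (Fin n → R) ≃ₗ[R] 𝒪) (A : 𝒪 →ₐ[R] Module.End R (Fin n → R))
    (he₀ : ∀ (a : 𝒪) (v : Fin n → R), e₀ (A a v) = a * e₀ v) (a : 𝒪) (g : Fin n → R⟦X⟧) :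
    coeffwise e₀ (coeffAct A a g) = PowerSeries.C a * coeffwise e₀ g := by
  ext m
  rw [coeff_coeffwise, coeffVec_coeffAct, he₀, coeff_C_mul, coeff_coeffwise]

/-- **H9's matrix currency.**  With `A := toLinAlgEquiv' ∘ Aρ` for an `R`-algebra map
`Aρ : 𝒪 → Matrix (Fin n) (Fin n) R` (↦ the constant `2`-adic matrices of H9), the coefficientwise action
reads `(a • g)ᵢ = ∑ⱼ C (Aρ a i j) * gⱼ` — k2-g18's H9 formula up to the index transpose `(i,j) ↔ (j,i)`. -/
theorem coeffAct_matrix (Aρ : 𝒪 →ₐ[R] Matrix (Fin n) (Fin n) R) (a : 𝒪) (g : Fin n → R⟦X⟧) (i : Fin n) :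
    coeffAct ((Matrix.toLinAlgEquiv' : Matrix (Fin n) (Fin n) R ≃ₐ[R] ((Fin n → R) →ₗ[R] (Fin n → R)))
      |>.toAlgHom.comp Aρ) a g i = ∑ j, PowerSeries.C (Aρ a i j) * g j := by
  ext m
  have h1 : coeff m (coeffAct ((Matrix.toLinAlgEquiv' : Matrix (Fin n) (Fin n) R ≃ₐ[R]
      ((Fin n → R) →ₗ[R] (Fin n → R))) |>.toAlgHom.comp Aρ) a g i) = ∑ j, Aρ a i j * coeff m (g j) := by
    simp [coeffAct, coeff_mk, Matrix.toLinAlgEquiv'_apply, Matrix.mulVec, dotProduct]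
  rw [h1, map_sum]
  exact Finset.sum_congr rfl fun j _ => by rw [coeff_C_mul]

/-- The trivialisation in closed form: `e g = ∑ᵢ map (gᵢ) · C bᵢ` with `bᵢ = e₀ (δᵢ)` — i.e.
`𝒪⟦X⟧ = ⊕ᵢ R⟦X⟧ · C bᵢ`, a FINITE direct sum (this is what makes H10d topology-free). -/
theorem coeffwise_eq_sum [DecidableEq (Fin n)] (e₀ : (Fin n → R) ≃ₗ[R] 𝒪) (g : Fin n → R⟦X⟧) :
    coeffwise e₀ g = ∑ i, PowerSeries.map (algebraMap R 𝒪) (g i) *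
      PowerSeries.C (e₀ (fun j => if i = j then (1 : R) else 0)) := by
  ext m
  rw [coeff_coeffwise, map_sum, pi_eq_sum_univ (coeffVec m g), map_sum]
  refine Finset.sum_congr rfl fun i _ => ?_
  rw [map_smul, coeff_mul_C, coeff_map, coeffVec_apply, Algebra.smul_def]

/-- **AGREEMENT with the tree (family 1).**  `coeffwiseEquiv e₀` satisfies, verbatim, the characterising formula
`e f = ∑ i, f i • C (b i)` of `Literature.RingTheory.PowerSeries.exists_linearEquiv_pi_of_basis`
[cite: Benhissi2022, Ch. 1 §9 Prop. 9.4 (3)] for the `R`-basis `b i := e₀ (Pi.single i 1)` of `𝒪`: so H10c's linear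
equivalence is that tree theorem (existential there, explicit here); what §3 adds is the INTERTWINING
`coeffwise_coeffAct` / `coeffAct_matrix` with H9's constant action, which that file does not treat. -/
theorem coeffwiseEquiv_apply_eq_sum_smul_C [DecidableEq (Fin n)] (e₀ : (Fin n → R) ≃ₗ[R] 𝒪)
    (g : Fin n → R⟦X⟧) :
    coeffwiseEquiv e₀ g = ∑ i, g i • (PowerSeries.C (e₀ (Pi.single i 1)) : 𝒪⟦X⟧) := by
  rw [coeffwiseEquiv_apply, coeffwise_eq_sum]
  refine Finset.sum_congr rfl fun i _ => ?_
  rw [Algebra.smul_def, algebraMap_apply'']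
  congr 3
  funext j
  simp only [Pi.single_apply, @eq_comm _ j i]

end Coeffwise

/-! ## §4 · H10d — ASSEMBLY: `e ∘ c` is `𝒪⟦X⟧`-linear from H8 (X-linearity) and H9 (constants via `A`) -/

section Assembly

variable {R 𝒪 : Type*} [CommRing R] [CommRing 𝒪] [Algebra R 𝒪] {n : ℕ}
variable {H : Type*} [AddCommGroup H] [Module 𝒪⟦X⟧ H]

/-- **H10d, semilinear form (matches H8 "up to the involution ι").**  Let `c : H →+ (Fin n → R⟦X⟧)`
be additive on an `𝒪⟦X⟧`-module `H` (↦ `I.H`, `c = π.cvec`), `τ`-SEMILINEAR for the `R⟦X⟧`-action through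
`map (algebraMap R 𝒪)` (↦ H8 via `iwasawaToIwasawaO`, `τ` = the Iwasawa involution on `ℤ₂⟦X⟧`, or `id`),
with constants `C a` acting through `A` (↦ H9).  If `e₀` trivialises `A` (H10b) and `τO` is a ring
endomorphism of `𝒪⟦X⟧` over `τ` fixing constants, then `e = coeffwiseEquiv e₀` makes `e ∘ c`
`τO`-semilinear over the WHOLE of `𝒪⟦X⟧`:  `e (c (φ • x)) = τO φ * e (c x)`.  Finite decomposition
`𝒪⟦X⟧ = ⊕ᵢ R⟦X⟧ · C bᵢ` only — no topology. -/
theorem trivialisation_semilinear (e₀ : (Fin n → R) ≃ₗ[R] 𝒪)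
    (A : 𝒪 →ₐ[R] Module.End R (Fin n → R))
    (he₀ : ∀ (a : 𝒪) (v : Fin n → R), e₀ (A a v) = a * e₀ v)
    (τ : R⟦X⟧ →+* R⟦X⟧) (τO : 𝒪⟦X⟧ →+* 𝒪⟦X⟧)
    (hτmap : ∀ r : R⟦X⟧, τO (PowerSeries.map (algebraMap R 𝒪) r) = PowerSeries.map (algebraMap R 𝒪) (τ r))
    (hτC : ∀ a : 𝒪, τO (PowerSeries.C a) = PowerSeries.C a)
    (c : H →+ (Fin n → R⟦X⟧))
    (hX : ∀ (r : R⟦X⟧) (x : H), c ((PowerSeries.map (algebraMap R 𝒪) r) • x) = τ r • c x)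
    (hO : ∀ (a : 𝒪) (x : H), c (PowerSeries.C a • x) = coeffAct A a (c x))
    (φ : 𝒪⟦X⟧) (x : H) :
    coeffwiseEquiv e₀ (c (φ • x)) = τO φ * coeffwiseEquiv e₀ (c x) := by
  classical
  obtain ⟨g, rfl⟩ : ∃ g, coeffwise e₀ g = φ := ⟨coeffwiseInv e₀ φ, coeffwise_coeffwiseInv e₀ φ⟩
  set b : Fin n → 𝒪 := fun i => e₀ (fun j => if i = j then (1 : R) else 0) with hb
  have hφ : coeffwise e₀ g = ∑ i, PowerSeries.map (algebraMap R 𝒪) (g i) * PowerSeries.C (b i) :=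
    coeffwise_eq_sum e₀ g
  -- expand the scalar `φ • x` along the finite decomposition
  have h1 : coeffwise e₀ g • x =
      ∑ i, (PowerSeries.map (algebraMap R 𝒪) (g i)) • (PowerSeries.C (b i) • x) := by
    rw [hφ, Finset.sum_smul]
    exact Finset.sum_congr rfl fun i _ => mul_smul _ _ _
  -- push `c` through: H8 then H9
  have h2 : c (coeffwise e₀ g • x) = ∑ i, (τ (g i)) • coeffAct A (b i) (c x) := by
    rw [h1, map_sum]
    exact Finset.sum_congr rfl fun i _ => by rw [hX, hO]
  -- push `e` through: `R⟦X⟧`-linearity of `e`, then the intertwining H10c′; and `τO` through the sum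
  rw [h2, map_sum, hφ, map_sum, Finset.sum_mul]
  refine Finset.sum_congr rfl fun i _ => ?_
  rw [map_smul, coeffwiseEquiv_apply, coeffwise_coeffAct e₀ A he₀, Algebra.smul_def,
    algebraMap_apply'', map_mul, hτmap, hτC, mul_assoc, coeffwiseEquiv_apply]

/-- **H10d / H10 (k2-g18), linear form** (`τ = id`): `e (c (φ • x)) = φ * e (c x)` for all `φ ∈ 𝒪⟦X⟧`. -/
theorem trivialisation_linear (e₀ : (Fin n → R) ≃ₗ[R] 𝒪) (A : 𝒪 →ₐ[R] Module.End R (Fin n → R))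
    (he₀ : ∀ (a : 𝒪) (v : Fin n → R), e₀ (A a v) = a * e₀ v)
    (c : H →+ (Fin n → R⟦X⟧))
    (hX : ∀ (r : R⟦X⟧) (x : H), c ((PowerSeries.map (algebraMap R 𝒪) r) • x) = r • c x)
    (hO : ∀ (a : 𝒪) (x : H), c (PowerSeries.C a • x) = coeffAct A a (c x))
    (φ : 𝒪⟦X⟧) (x : H) :
    coeffwiseEquiv e₀ (c (φ • x)) = φ * coeffwiseEquiv e₀ (c x) := by
  simpa using trivialisation_semilinear e₀ A he₀ (RingHom.id _) (RingHom.id _) (fun _ => rfl)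
    (fun _ => rfl) c (fun r x => by simpa using hX r x) hO φ x

end Assembly

/-! ## §4b · H9-pkg — `2`-adic packaging of the levelwise Schur matrices
(tree: `ThetaTransport.decomp_equivariant_addMonoidHom_pi_primary_eq_sum_nsmul` gives, at each layer `2^m`, an
ℕ-matrix `C_m` with `Φ = C_m` on `W[2^m]ⁿ`; faithfulness of `W[2^m] ≅ (ℤ/2^m)²` makes `C_m mod 2^m` unique, hence
compatible; this § turns the compatible family into ONE matrix over `ℤ_[2]` — the entries of H9's `Aρ a`.)
Family-1 verdict: the HOM form of this packaging is IN TREE — `Literature.Algebra.InverseSystem.padicIntLift`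
(`toZModPow_padicIntLift`, `eq_padicIntLift_of_toZModPow`, successor-step compatibility; companion
`AddInverseLimit.padicIntAddEquiv : ℤ_[p] ≃+ lim ℤ/p^m`) — the two lemmas below are the ELEMENT / MATRIX
repackaging with `≤`-indexed compatibility (what the levelwise Schur matrices come with), via Mathlib's
`PadicInt.lift` on `ℤ[X]`; either brick serves PLAN 2. -/

section PadicPackaging

variable {p : ℕ} [Fact p.Prime]

/-- **H9-pkg (scalars).** A family of residues `c k ∈ ℤ/p^k`, compatible under the castHoms, is the
reduction of a unique `p`-adic integer (`PadicInt.lift` applied to `ℤ[X] → ℤ/p^k, X ↦ c k`). -/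
theorem exists_unique_toZModPow_eq (c : ∀ k : ℕ, ZMod (p ^ k))
    (hc : ∀ (k₁ k₂ : ℕ) (hk : k₁ ≤ k₂), ZMod.castHom (pow_dvd_pow p hk) (ZMod (p ^ k₁)) (c k₂) = c k₁) :
    ∃! a : ℤ_[p], ∀ k, PadicInt.toZModPow k a = c k := by
  let f : ∀ k : ℕ, Polynomial ℤ →+* ZMod (p ^ k) := fun k => (Polynomial.aeval (R := ℤ) (c k)).toRingHom
  have hf : ∀ k, f k Polynomial.X = c k := fun k => by simp [f]
  have f_compat : ∀ (k₁ k₂ : ℕ) (hk : k₁ ≤ k₂),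
      (ZMod.castHom (pow_dvd_pow p hk) (ZMod (p ^ k₁))).comp (f k₂) = f k₁ := by
    intro k₁ k₂ hk
    apply Polynomial.ringHom_ext
    · intro n
      simp [f]
    · rw [RingHom.comp_apply, hf, hf, hc k₁ k₂ hk]
  have hval : ∀ k, PadicInt.toZModPow k (PadicInt.lift f_compat Polynomial.X) = c k := by
    intro k
    rw [← hf k, ← PadicInt.lift_spec f_compat k, RingHom.comp_apply]
  exact ⟨PadicInt.lift f_compat Polynomial.X, hval, fun b hb =>
    PadicInt.ext_of_toZModPow.mp fun k => by rw [hb k, hval k]⟩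

/-- **H9-pkg (matrices).** Levelwise constant matrices `C k ∈ M_n(ℤ/p^k)` (IntegralSchur at each layer),
compatible under reduction, are the reductions of a unique `A ∈ M_n(ℤ_p)`. -/
theorem exists_unique_matrix_toZModPow_eq {ι : Type*} (C : ∀ k : ℕ, Matrix ι ι (ZMod (p ^ k)))
    (hC : ∀ (k₁ k₂ : ℕ) (hk : k₁ ≤ k₂),
      (C k₂).map (ZMod.castHom (pow_dvd_pow p hk) (ZMod (p ^ k₁))) = C k₁) :
    ∃! A : Matrix ι ι ℤ_[p], ∀ k, A.map (PadicInt.toZModPow k) = C k := by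
  have h := fun i j => exists_unique_toZModPow_eq (p := p) (fun k => C k i j)
    (fun k₁ k₂ hk => by rw [← hC k₁ k₂ hk]; rfl)
  refine ⟨fun i j => (h i j).choose, fun k => ?_, fun B hB => ?_⟩
  · ext i j
    exact (h i j).choose_spec.1 k
  · ext i j
    exact (h i j).unique (fun k => by rw [← hB k]; rfl) (h i j).choose_spec.1


end PadicPackaging

/-! ## §5 · H12 — `λ_𝒪` of a principal quotient is invariant under an `𝒪`-algebra automorphism of `Λ_𝒪` -/

section Involution

open scoped TensorProduct

variable {A Λ : Type*} [CommRing A] [CommRing Λ] [Algebra A Λ]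

/-- The `A`-linear identification `Λ ⧸ (σ h) ≃ Λ ⧸ (h)` induced by an `A`-algebra automorphism `σ`
(RTT: `A = 𝒪`, `Λ = Λ_𝒪 = IwasawaAlgebraO S`, `σ = ι` the Iwasawa involution `X ↦ (1+X)⁻¹ - 1`). -/
def quotSpanEquivOfAlgEquiv (σ : Λ ≃ₐ[A] Λ) (h : Λ) :
    (Λ ⧸ Ideal.span {h}) ≃ₗ[A] (Λ ⧸ Ideal.span {σ h}) :=
  (Ideal.quotientEquivAlg (Ideal.span {h}) (Ideal.span {σ h}) σ (by
    rw [Ideal.map_span, Set.image_singleton]; rfl)).toLinearEquiv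

/-- **H12 (abstract).**  For ANY `A`-algebra `K` (RTT: `K = FractionRing 𝒪`, so both sides are
`lamO S (Λ_𝒪 ⧸ ·)` by `lamO_eq`, definitional): `dim_K (K ⊗_A Λ⧸(σ h)) = dim_K (K ⊗_A Λ⧸(h))`. -/
theorem finrank_baseChange_quot_span_algEquiv (K : Type*) [CommRing K] [Algebra A K]
    (σ : Λ ≃ₐ[A] Λ) (h : Λ) :
    Module.finrank K (K ⊗[A] (Λ ⧸ Ideal.span {σ h})) =
      Module.finrank K (K ⊗[A] (Λ ⧸ Ideal.span {h})) :=
  (LinearEquiv.finrank_eq ((quotSpanEquivOfAlgEquiv σ h).baseChange A K _ _)).symm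

end Involution

/-! ## §5b · D1 — the Iwasawa involution `ι : X ↦ (1+X)⁻¹ - 1` as an `A`-algebra automorphism of `A⟦X⟧`, GENERAL `A`
Family-1 verdict: the tree's `IwasawaAlgebra.invol p / involEquiv p` (`Literature/…/IwasawaAlgebraInvolution.lean`) is this
object for `A = ℤ_[p]` only; the substituted series exists for every `R` as `Literature.Barriers.BirchSwinnertonDyer.invOnePlusSubOne`
(with `invOnePlusSubOne_subst_self` under `[IsDomain R]`).  Below: the same `substAlgHom` recipe over any commutative ring `A`
ON THE TREE'S SERIES (no new series is introduced), involutive WITHOUT `IsDomain` (cancel the unit `(1+X)⁻¹` instead of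
`mul_left_cancel₀`), bundled as `≃ₐ[A]`, plus `map`-compatibility and the agreement with `invol p` at `A = ℤ_[p]`. -/

section IwasawaInvolution

open Literature.Barriers.BirchSwinnertonDyer (invOnePlusSubOne coeff_invOnePlusSubOne constantCoeff_invOnePlusSubOne
  hasSubst_invOnePlusSubOne one_add_X_mul_invOnePlusSubOne_add_one)

variable {A : Type*} [CommRing A]

/-- The Iwasawa involution `X ↦ (1+X)⁻¹ - 1` (i.e. `γ ↦ γ⁻¹` on `1 + X = γ`) as an `A`-algebra hom, substituting the
TREE's series `invOnePlusSubOne` (= `IwasawaAlgebra.invol p` when `A = ℤ_[p]`: `iota_eq_invol`).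
[cite: Washington1997, §13.2] -/
def iotaHom : A⟦X⟧ →ₐ[A] A⟦X⟧ := substAlgHom (R := A) (hasSubst_invOnePlusSubOne (R := A))

theorem iotaHom_apply (f : A⟦X⟧) : iotaHom f = subst (invOnePlusSubOne : A⟦X⟧) f := by
  rw [iotaHom, coe_substAlgHom]

theorem iotaHom_X : iotaHom (X : A⟦X⟧) = invOnePlusSubOne := by
  rw [iotaHom_apply, subst_X hasSubst_invOnePlusSubOne]

theorem iotaHom_one_add_X : iotaHom (1 + X : A⟦X⟧) = invOnePlusSubOne + 1 := by
  rw [map_add, map_one, iotaHom_X, add_comm]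

/-- `ι (ι X) = X` over ANY commutative ring: apply `ι` to `(1+X)·(1+X)⁻¹ = 1` and cancel the unit `(1+X)⁻¹`
(the tree's `invOnePlusSubOne_subst_self` assumes `IsDomain`). -/
theorem iotaHom_invOnePlusSubOne : iotaHom (invOnePlusSubOne : A⟦X⟧) = X := by
  have h1 : (invOnePlusSubOne + 1 : A⟦X⟧) * iotaHom (invOnePlusSubOne + 1) = 1 := by
    have h := congrArg iotaHom (one_add_X_mul_invOnePlusSubOne_add_one (R := A))
    rwa [map_mul, iotaHom_one_add_X, map_one] at h
  have h2 : iotaHom (invOnePlusSubOne + 1 : A⟦X⟧) = 1 + X := by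
    calc iotaHom (invOnePlusSubOne + 1 : A⟦X⟧)
          = ((1 + X) * (invOnePlusSubOne + 1)) * iotaHom (invOnePlusSubOne + 1) := by
            rw [one_add_X_mul_invOnePlusSubOne_add_one, one_mul]
      _ = 1 + X := by rw [mul_assoc, h1, mul_one]
  rw [map_add, map_one, add_comm (1 : A⟦X⟧) X] at h2
  exact add_right_cancel h2

theorem iotaHom_iotaHom (f : A⟦X⟧) : iotaHom (iotaHom f) = f := by
  rw [iotaHom_apply, iotaHom_apply,
    subst_comp_subst_apply hasSubst_invOnePlusSubOne hasSubst_invOnePlusSubOne, ← iotaHom_apply,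
    iotaHom_invOnePlusSubOne, X_subst]

/-- **D1.** The Iwasawa involution as an `A`-algebra automorphism of `A⟦X⟧` (general `A`; the tree's
`IwasawaAlgebra.involEquiv p` is the case `A = ℤ_[p]`). [cite: Washington1997, §13.2] -/
def iota : A⟦X⟧ ≃ₐ[A] A⟦X⟧ :=
  AlgEquiv.ofAlgHom iotaHom iotaHom (AlgHom.ext iotaHom_iotaHom) (AlgHom.ext iotaHom_iotaHom)

theorem iota_apply (f : A⟦X⟧) : iota f = iotaHom f := rfl

theorem iota_X : iota (X : A⟦X⟧) = invOnePlusSubOne := iotaHom_X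

theorem iota_one_add_X_mul : iota (1 + X : A⟦X⟧) * (1 + X) = 1 := by
  rw [iota_apply, iotaHom_one_add_X, mul_comm]
  exact one_add_X_mul_invOnePlusSubOne_add_one

theorem iota_iota (f : A⟦X⟧) : iota (iota f) = f := iotaHom_iotaHom f

/-- `ι` commutes with coefficientwise maps (RTT: `ι_𝒪 ∘ iwasawaToIwasawaO = iwasawaToIwasawaO ∘ ι_{ℤ₂}`,
the hypothesis `hτmap` of `trivialisation_semilinear`). -/
theorem map_iota {B : Type*} [CommRing B] (φ : A →+* B) (f : A⟦X⟧) :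
    PowerSeries.map φ (iota f) = iota (PowerSeries.map φ f) := by
  have hmap : PowerSeries.map φ (invOnePlusSubOne : A⟦X⟧) = invOnePlusSubOne := by
    ext k
    rw [coeff_map, coeff_invOnePlusSubOne, coeff_invOnePlusSubOne]
    split_ifs <;> simp
  have hmap' : MvPowerSeries.map φ (invOnePlusSubOne : A⟦X⟧) = invOnePlusSubOne := hmap
  have h := map_subst hasSubst_invOnePlusSubOne (h := φ) f
  rw [hmap'] at h
  rw [iota_apply, iota_apply, iotaHom_apply, iotaHom_apply]
  exact h

/-- `ι` fixes constants (the hypothesis `hτC` of `trivialisation_semilinear`). -/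
theorem iota_C (a : A) : iota (PowerSeries.C a : A⟦X⟧) = PowerSeries.C a :=
  (iota (A := A)).commutes a

/-- The two tree spellings of `(1+T)⁻¹ − 1` over `ℤ_[p]` agree (= TP2's
`Theorems.SignedKatoOffTwo.Invol.invSubOne_eq_invOnePlusSubOne`, re-derived in five lines to keep this sketch's
import closure inside `Literature`): both `1 + (·)` invert the unit `1 + T`. -/
theorem invSubOne_eq_invOnePlusSubOne (p : ℕ) [Fact p.Prime] :
    Literature.NumberTheory.EllipticCurves.IwasawaAlgebra.invSubOne p = (invOnePlusSubOne : ℤ_[p]⟦X⟧) := by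
  have h1 := Literature.NumberTheory.EllipticCurves.IwasawaAlgebra.one_add_X_mul_one_add_invSubOne p
  have h2 : (1 + X : ℤ_[p]⟦X⟧) * (1 + invOnePlusSubOne) = 1 := by
    rw [add_comm (1 : ℤ_[p]⟦X⟧) invOnePlusSubOne]; exact one_add_X_mul_invOnePlusSubOne_add_one
  have hu : IsUnit (1 + X : ℤ_[p]⟦X⟧) := by
    rw [PowerSeries.isUnit_iff_constantCoeff, map_add, map_one, constantCoeff_X, add_zero]; exact isUnit_one
  exact add_left_cancel (hu.mul_left_cancel (h1.trans h2.symm))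

/-- **AGREEMENT.** At `A = ℤ_[p]`, `iota` IS the tree's Iwasawa involution `IwasawaAlgebra.invol p`. -/
theorem iota_eq_invol (p : ℕ) [Fact p.Prime] (f : ℤ_[p]⟦X⟧) :
    iota f = Literature.NumberTheory.EllipticCurves.IwasawaAlgebra.invol p f := by
  rw [iota_apply, iotaHom_apply, Literature.NumberTheory.EllipticCurves.IwasawaAlgebra.invol_apply,
    invSubOne_eq_invOnePlusSubOne]

/-- **`hτmap` of §4, literally**: `ι_B (map φ r) = map φ (invol p r)` for any `φ : ℤ_[p] →+* B`
(RTT: `B = 𝒪`, `φ = padicIntToCoeffIntegers S`, `map φ = iwasawaToIwasawaO S`). -/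
theorem iota_map_eq_map_invol (p : ℕ) [Fact p.Prime] {B : Type*} [CommRing B] (φ : ℤ_[p] →+* B)
    (r : ℤ_[p]⟦X⟧) :
    iota (PowerSeries.map φ r) =
      PowerSeries.map φ (Literature.NumberTheory.EllipticCurves.IwasawaAlgebra.invol p r) := by
  rw [← iota_eq_invol, map_iota]

end IwasawaInvolution





open Summit.BirchSwinnertonDyer.BirchSwinnertonDyer.Theorems.LambdaLowerBoundO

/-! ### §6a. The `K`-form over any field `K ⊇ 𝒪_E` (k3-g4 §G `…_normLambda_field`, re-checked; here only
`Function.Injective (algebraMap 𝒪_E K)` is assumed) -/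

section UnitBall

open Literature.NumberTheory.Automorphic PowerSeries

variable (p : ℕ) [Fact p.Prime] (E : IntermediateField ℚ_[p] (PadicAlgCl p)) [FiniteDimensional ℚ_[p] E]

/-- **`dim_K (K ⊗_{𝒪_E} 𝒪_E⟦T⟧/(L)) = d`** for every field `K` into which `𝒪_E` embeds (`L = C(c)·L₀`,
`𝒪⟦T⟧/(L₀)` free of rank `d`, the kernel of `𝒪⟦T⟧/(L) ↠ 𝒪⟦T⟧/(L₀)` is killed by `c`, a unit in `K`).
Verbatim re-run of the tree's `finrank_baseChange_quotient_span_eq_of_normLambda` with `E ↦ K`.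
[cite: Washington1997, §7.1 Thm. 7.3 and §13.2] -/
theorem finrank_baseChange_quotient_span_eq_of_normLambda_field (K : Type*) [Field K]
    [Algebra (PadicIntermediateField.unitBall p E) K]
    (hK : Function.Injective (algebraMap (PadicIntermediateField.unitBall p E) K))
    (L : PowerSeries (PadicIntermediateField.unitBall p E)) (d : ℕ) (hL : L ≠ 0)
    (hle : ∀ k, ‖((coeff k L : PadicIntermediateField.unitBall p E) : PadicAlgCl p)‖ ≤
      ‖((coeff d L : PadicIntermediateField.unitBall p E) : PadicAlgCl p)‖)
    (hlt : ∀ k, k < d → ‖((coeff k L : PadicIntermediateField.unitBall p E) : PadicAlgCl p)‖ <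
      ‖((coeff d L : PadicIntermediateField.unitBall p E) : PadicAlgCl p)‖) :
    Module.finrank K (K ⊗[PadicIntermediateField.unitBall p E]
      (PowerSeries (PadicIntermediateField.unitBall p E) ⧸ Ideal.span {L})) = d := by
  obtain ⟨L₀, hfac, hc0, hd1, hlow⟩ := exists_eq_C_mul_of_normLambda p E L d hL hle hlt
  set c := coeff d L with hc
  obtain ⟨hfree, hfin, hrank⟩ :=
    free_finrank_quotient_span_of_order_eq p E L₀ d (order_map_residue_eq L₀ d hd1 hlow)
  haveI := hfree
  haveI := hfin
  have hle' : Ideal.span {L} ≤ Ideal.span {L₀} := by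
    rw [Ideal.span_singleton_le_span_singleton, hfac]
    exact Dvd.intro_left _ rfl
  let π : (PowerSeries (PadicIntermediateField.unitBall p E) ⧸ Ideal.span {L}) →ₐ[
      PadicIntermediateField.unitBall p E]
      (PowerSeries (PadicIntermediateField.unitBall p E) ⧸ Ideal.span {L₀}) :=
    Ideal.Quotient.factorₐ (PadicIntermediateField.unitBall p E) hle'
  have hπ : Function.Surjective π.toLinearMap := Ideal.Quotient.factor_surjective hle'
  have hker : ∀ x ∈ LinearMap.ker π.toLinearMap, c • x = 0 := by
    intro x hx
    obtain ⟨y, rfl⟩ := Ideal.Quotient.mk_surjective x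
    rw [LinearMap.mem_ker, AlgHom.toLinearMap_apply, Ideal.Quotient.factorₐ_apply_mk,
      Ideal.Quotient.eq_zero_iff_mem, Ideal.mem_span_singleton'] at hx
    obtain ⟨z, rfl⟩ := hx
    change Ideal.Quotient.mk (Ideal.span {L}) (c • (z * L₀)) = 0
    rw [Ideal.Quotient.eq_zero_iff_mem, smul_eq_C_mul, Ideal.mem_span_singleton']
    exact ⟨z, by rw [hfac]; ring⟩
  have hcK : IsUnit (algebraMap (PadicIntermediateField.unitBall p E) K c) := by
    rw [isUnit_iff_ne_zero]
    intro h0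
    apply hc0
    apply hK
    rw [h0, map_zero]
  rw [finrank_baseChange_eq_of_surjective_of_smul_ker_eq_zero K π.toLinearMap hπ c hcK hker,
    Module.finrank_baseChange, hrank]

end UnitBall

/-! ### §6b. **W-d** on the crux's carriers: `lamO S (Λ_𝒪 ⧸ (Lm)) = d`
(= k3-g4 `Sketch_sidea_k3_g4.lean` §G `…_iwasawaAlgebraO` with `K := FractionRing 𝒪`, in `lamO` currency) -/

section CruxCurrency

open Literature.NumberTheory.Automorphic Literature.NumberTheory.EllipticCurves PowerSeries

variable (p : ℕ) [Fact p.Prime] (S : Set (PadicAlgCl p)) [FiniteDimensional ℚ_[p] (padicCoeffField S)]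

/-- **W-d (S109 / V105 (e)) — the seam's `hd`.**  For `Lm ∈ Λ_𝒪 = IwasawaAlgebraO S`, `Lm ≠ 0`, and `d`
with exactly RSL_g's norm binders on `iwasawaOToPowerSeries S Lm` (`‖coeff k‖ ≤ ‖coeff d‖`, `<` for
`k < d`):  `lamO S (Λ_𝒪 ⧸ (Lm)) = d`.  (`lamO_eq` + §1 with `K = Frac 𝒪`, transported along
`padicCoeffIntegers_eq_unitBall` like the tree's `…_iwasawaAlgebraO`.) [cite: Washington1997, §7.1 Thm. 7.3 and §13.2] -/
theorem lamO_quotient_span_eq_of_normLambda_iwasawaAlgebraO :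
    ∀ (Lm : IwasawaAlgebraO S) (d : ℕ), Lm ≠ 0 →
      (∀ k : ℕ, ‖coeff k (iwasawaOToPowerSeries S Lm)‖ ≤ ‖coeff d (iwasawaOToPowerSeries S Lm)‖) →
      (∀ k : ℕ, k < d → ‖coeff k (iwasawaOToPowerSeries S Lm)‖ < ‖coeff d (iwasawaOToPowerSeries S Lm)‖) →
      Theorems.OnePair.lamO S (IwasawaAlgebraO S ⧸ Ideal.span {Lm}) = d := by
  simp only [Theorems.OnePair.lamO_eq, coeff_iwasawaOToPowerSeries]
  unfold IwasawaAlgebraO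
  rw [padicCoeffIntegers_eq_unitBall S]
  intro Lm d hL hle hlt
  exact finrank_baseChange_quotient_span_eq_of_normLambda_field p (padicCoeffField S) _
    (IsFractionRing.injective _ _) Lm d hL hle hlt

omit [FiniteDimensional ℚ_[p] (padicCoeffField S)] in
/-- **H12 in RTT currency (S109 price item H12, with D1 instantiated):** for every `h ∈ Λ_𝒪 = IwasawaAlgebraO S`,
`lamO S (Λ_𝒪 ⧸ (ι h)) = lamO S (Λ_𝒪 ⧸ (h))` — the involution ambiguity of H8 (`T ↦ (1+T)⁻¹ - 1`, fixed by the
sign convention of `locd₂`; Greenberg, LNM 1716, Thm. 1.14's `θ^ι`) does not move the count the seam reads.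
[cite: Washington1997, §13.2] -/
theorem lamO_quot_span_iota_eq (h : IwasawaAlgebraO S) :
    Theorems.OnePair.lamO S (IwasawaAlgebraO S ⧸ Ideal.span {iota (A := padicCoeffIntegers S) h}) =
      Theorems.OnePair.lamO S (IwasawaAlgebraO S ⧸ Ideal.span {h}) := by
  simp only [Theorems.OnePair.lamO_eq]
  exact finrank_baseChange_quot_span_algEquiv _ (iota (A := padicCoeffIntegers S)) h

omit [FiniteDimensional ℚ_[p] (padicCoeffField S)] in
/-- … and for ANY `𝒪`-algebra automorphism `σ` of `Λ_𝒪` (a stray unit/renormalisation of `T`). -/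
theorem lamO_quot_span_algEquiv_eq (σ : IwasawaAlgebraO S ≃ₐ[padicCoeffIntegers S] IwasawaAlgebraO S)
    (h : IwasawaAlgebraO S) :
    Theorems.OnePair.lamO S (IwasawaAlgebraO S ⧸ Ideal.span {σ h}) =
      Theorems.OnePair.lamO S (IwasawaAlgebraO S ⧸ Ideal.span {h}) := by
  simp only [Theorems.OnePair.lamO_eq]
  exact finrank_baseChange_quot_span_algEquiv _ σ h

end CruxCurrency

end

end Summit.BirchSwinnertonDyer.BirchSwinnertonDyer.Cruxes.ResidualThetaCountLowerPureAtTwo.SideaK2G19
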